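import Mathlib
import Literature.AlgebraicGeometry.Resolution.AffineBlowupAlgebra
import Literature.AlgebraicGeometry.Resolution.AffineBlowupIntegral
import Summits.ResolutionOfSingularities.ResolutionOfSingularities.Theorems.WildQuotientsWildQuotientResolutionJordanThreeOneBlowup
import Summits.ResolutionOfSingularities.ResolutionOfSingularities.Theorems.WildQuotientsWildQuotientResolutionToricChartRegular
/-!
# Toric chart certificates — cover relations and the assembly theorem

(crux stmt-ResolutionOfSingularities-15640 `WildQuotients.WildQuotientResolution`, line `Sketch`,
sector `|G| = p`; next rung R-T — the cone lane, soundness of toric chart certificates, part 4/4.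
[OURS · L1 W4.5c] — NOT a statement of any manuscript; replaces the role of no printed item.
Prover res-L1-w45c-stub-4 (gen 4).)

* `reesT_pow_eq_of_check` / `basicOpen_le_of_check` — a checked relation certificate
  `L·g_l = Σ κ_i g_i + (cone word)`, `κ_j ≥ 1`, is the Rees identity
  `(cc l · t)^L = ∏ (cc i · t)^{κ_i} · w`, hence `D₊(cc l · t) ≤ D₊(cc j · t)`;
* `blowup_regular_of_certificates` — chart certificates at the vertices + relation certificates for
  all generators ⇒ the blow-up of `Spec A` along the monomial centre is regular
  (`JordanThree.isRegular_affineBlowup_of_charts`), integral, proper and birational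
  (`affineBlowup.isIntegral / isBirational`).
-/

-- single-problem summit: the doubled namespace component `ResolutionOfSingularities` is forced
set_option linter.dupNamespace false

noncomputable section

open MvPolynomial IsLocalization
open Literature.AlgebraicGeometry.Resolution

namespace Summit.ResolutionOfSingularities.ResolutionOfSingularities.Theorems.WildQuotientResolution.ToricChart

variable {d r : ℕ}

section Cover

open AlgebraicGeometry CategoryTheory

variable (k : Type) [Field k] (P : Type) (D : ConeDatum d r) {m : ℕ} (G : Fin m → Word d r)

/-- **The Rees relation of a checked relation certificate**:
`(cc l · t)^L = (∏_i (cc i · t)^{kap i}) · (wordElem W)` in the Rees algebra `A[𝔞 t]`.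
[OURS · L1 W4.5c] -/
theorem reesT_pow_eq_of_check (R : RelCert d r m) (l j : Fin m) (hR : R.check D G l j = true) :
    reesT (I := Ideal.span (Set.range fun i : Fin m => wordElem k P D (G i)))
        (wordElem k P D (G l)) (Ideal.mem_span_range_self (f := fun i : Fin m =>
          wordElem k P D (G i)) (x := l)) ^ R.L =
      (∏ i : Fin m, reesT (I := Ideal.span (Set.range fun i : Fin m => wordElem k P D (G i)))
        (wordElem k P D (G i)) (Ideal.mem_span_range_self (f := fun i : Fin m =>
          wordElem k P D (G i)) (x := i)) ^ R.kap i) *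
      algebraMap (Ring k P D) _ (wordElem k P D R.W) := by
  obtain ⟨_, hsum, hexp⟩ := of_decide_eq_true hR
  apply Subtype.ext
  simp only [Subalgebra.coe_pow, Subalgebra.coe_mul, SubmonoidClass.coe_finsetProd, coe_reesT,
    Subalgebra.coe_algebraMap, Polynomial.monomial_pow, Polynomial.algebraMap_eq, one_mul]
  rw [prod_monomial, Polynomial.monomial_mul_C, ← fsum_eq_sum, hsum]
  congr 1
  apply theta_injective
  rw [map_pow, theta_wordElem, map_mul, map_prod, theta_wordElem]
  simp only [map_pow, theta_wordElem]
  rw [prod_xmon_pow, ← xmon_smul, ← xmon_add]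
  congr 1
  funext t
  rw [Pi.smul_apply, smul_eq_mul, Pi.add_apply, Finset.sum_apply, hexp t, fsum_eq_sum]
  simp only [Pi.smul_apply, smul_eq_mul]

/-- **A checked relation certificate gives `D₊(cc l · t) ≤ D₊(cc j · t)`.** [OURS · L1 W4.5c] -/
theorem basicOpen_le_of_check (R : RelCert d r m) (l j : Fin m) (hR : R.check D G l j = true) :
    Proj.basicOpen
        (reesGrading (Ideal.span (Set.range fun i : Fin m => wordElem k P D (G i))))
        (reesT (wordElem k P D (G l)) (Ideal.mem_span_range_self
          (f := fun i : Fin m => wordElem k P D (G i)) (x := l))) ≤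
      Proj.basicOpen
        (reesGrading (Ideal.span (Set.range fun i : Fin m => wordElem k P D (G i))))
        (reesT (wordElem k P D (G j)) (Ideal.mem_span_range_self
          (f := fun i : Fin m => wordElem k P D (G i)) (x := j))) := by
  classical
  have hR' := of_decide_eq_true hR
  have hkap : 1 ≤ R.kap j := hR'.1
  have hL : 0 < R.L := by
    have h2 := hR'.2.1
    rw [fsum_eq_sum] at h2
    have : R.kap j ≤ ∑ i, R.kap i := Finset.single_le_sum (fun i _ => Nat.zero_le _) (Finset.mem_univ j)
    omega
  let 𝒜 := reesGrading (Ideal.span (Set.range fun i : Fin m => wordElem k P D (G i)))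
  let T : Fin m → reesAlgebra (Ideal.span (Set.range fun i : Fin m => wordElem k P D (G i))) :=
    fun i => reesT (wordElem k P D (G i)) (Ideal.mem_span_range_self
      (f := fun i : Fin m => wordElem k P D (G i)) (x := i))
  change Proj.basicOpen 𝒜 (T l) ≤ Proj.basicOpen 𝒜 (T j)
  rw [← Proj.basicOpen_pow 𝒜 (T l) R.L hL]
  have hrel : T l ^ R.L = (∏ i : Fin m, T i ^ R.kap i) * algebraMap (Ring k P D) _ (wordElem k P D R.W) :=
    reesT_pow_eq_of_check k P D G R l j hR
  rw [hrel, Proj.basicOpen_mul, ← Finset.mul_prod_erase Finset.univ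
    (fun i => T i ^ R.kap i) (Finset.mem_univ j), Proj.basicOpen_mul,
    Proj.basicOpen_pow 𝒜 (T j) (R.kap j) hkap]
  exact inf_le_left.trans inf_le_left

/-- **The assembly theorem**: if every generator `cc l` of the monomial centre carries a checked
relation certificate pointing at a vertex `vtx (vidx l)`, and every vertex `vtx j` carries a checked
chart certificate, then the blow-up of the presented cone ring `A` along `𝔞 = (cc l)_l` is REGULAR,
integral, and proper birational over `Spec A`. [OURS · L1 W4.5c] -/
theorem blowup_regular_of_certificates [Finite P] (hm : 0 < m) {ν : ℕ} (vtx : Fin ν → Fin m)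
    (vidx : Fin m → Fin ν) (cert : Fin ν → ChartCert d r m) (rel : Fin m → RelCert d r m)
    (hcert : ∀ j : Fin ν, (cert j).check D G (vtx j) = true)
    (hrel : ∀ l : Fin m, (rel l).check D G l (vtx (vidx l)) = true) :
    Scheme.IsRegular (affineBlowup (Ideal.span (Set.range fun i : Fin m =>
        wordElem k P D (G i)))) ∧
      IsIntegral (affineBlowup (Ideal.span (Set.range fun i : Fin m =>
        wordElem k P D (G i)))) ∧
      IsProper (affineBlowup.π (Ideal.span (Set.range fun i : Fin m =>
        wordElem k P D (G i)))) ∧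
      IsBirational (affineBlowup.π (Ideal.span (Set.range fun i : Fin m =>
        wordElem k P D (G i)))) := by
  haveI : IsDomain (Ring k P D) := isDomain_ring
  have hne : Ideal.span (Set.range fun i : Fin m => wordElem k P D (G i)) ≠ ⊥ := by
    intro h
    rw [Ideal.span_eq_bot] at h
    exact wordElem_ne_zero (G ⟨0, hm⟩) (h _ ⟨⟨0, hm⟩, rfl⟩)
  refine ⟨JordanThree.isRegular_affineBlowup_of_charts _ fun i => ⟨vtx (vidx i),
    isRegularRing_chartRing_of_check k P D G (vtx (vidx i)) (cert (vidx i)) (hcert (vidx i)),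
    basicOpen_le_of_check k P D G (rel i) i (vtx (vidx i)) (hrel i)⟩,
    affineBlowup.isIntegral hne, inferInstance, affineBlowup.isBirational hne⟩

end Cover

end Summit.ResolutionOfSingularities.ResolutionOfSingularities.Theorems.WildQuotientResolution.ToricChart

end
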